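import Summits.ResolutionOfSingularities.ResolutionOfSingularities.Theorems.EquisingularLiftEquisingularLiftNatPointExit
import Summits.ResolutionOfSingularities.ResolutionOfSingularities.Theorems.EquisingularLiftEquisingularLiftNatStageCut
import Summits.ResolutionOfSingularities.ResolutionOfSingularities.Theorems.EquisingularLiftEquisingularLiftNatFirstTouch
import Summits.ResolutionOfSingularities.ResolutionOfSingularities.Theorems.EquisingularLiftEquisingularLiftNatFirstProgressTouch
import Summits.ResolutionOfSingularities.ResolutionOfSingularities.Theorems.EquisingularLiftEquisingularLiftNatPointStep
import HarnessLib

/-!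
# [OURS · L1 W4.5(b) · EL♮] EXIT ⇒ ISOLATED: a point-resolvable configuration has finitely many non-regular points
# (crux `EquisingularLiftNat` = stmt-ResolutionOfSingularities-20038, band `4 ≤ n`; res-L1-w45b-plan-1's TARGET-ExitIsolated.lean 548cd05717e071d5,
# SIZING CORRECTION 2026-08-27T14:00:46Z; proved by res-L1-w45b-lead-1)

HONEST FRAMING. OURS (cell res-hironaka, crux chain w45b, slot W4.5(b)); NOT a statement of any manuscript; replaces the role of NOTHING in the
manuscript; AI-written, AI review is weaker than expert review. Helper `--supports stmt-ResolutionOfSingularities-20038 --as helper`. No `sorry`;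
standard axioms.

WHAT.
* `ptResolvable_singSet_finite (F₀) (T₀) : PtResolvable F₀ T₀ → (singSet T₀).Finite` — if `V(closure T₀)_red ⊆ F₀` becomes regular after finitely
  many blow-ups of the ambient at NON-REGULAR CLOSED points of the current reduced strict transform (`PtResolvable`, the downstairs hypothesis of
  T-ISO-0-REL), then `V(closure T₀)_red` has only FINITELY MANY non-regular points (all scheme points, no excellence / openness-of-Reg needed).
  Proof: induction over the `PtResolvable` closure predicate with the invariant «there is a finite `Φ ⊆ V(closure T₀)` such that every `x₀ ∉ Φ` has a
  PARTNER `x₁` on the current reduced strict transform lying over it with `𝒪_{x₁}` regular iff `𝒪_{x₀}` regular»: a step blows up ONE closed point `P`;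
  off `P` the blow-up is an isomorphism (`IsBlowup.isIso_morphismRestrict`) under which the reduced strict transforms correspond
  (`closure_preimage_diff_inter_compl_eq` + `StrataSplit.stub_reducedStalkOverIso`), so partners persist for every `x₀` not under `P`, and `Φ` grows by
  the (at most one) point under `P`. At the end all stalks are regular, so `singSet T₀ ⊆ Φ`.
* `singSet_finite_of_iso` — finiteness of the non-regular locus is invariant under isomorphisms of the reduced strict transforms.
* `geFourReachIsolated_of_geFourReachExit (p) : GeFourReachExit p → GeFourReachIsolated p` — an EXIT stage (`ExitAt`: `GoodSet` and
  `V(closure S₁)_red ≅` a point-resolvable `V(closure T₀)_red`) IS an isolated stage (`(singSet S₁).Finite ∧ GoodSet`), so the registered residual stub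
  `stub_elnat_ge_four_reachExit` (parent skeleton v13) implies piece A `GeFourReachIsolated`; with res-L1-w45b-plan-1's reading, a `¬A` witness
  refutes the registered stub (kill test #50's formal entry).

References: Theorems/EquisingularLiftEquisingularLiftNatPointExit.lean (`PtResolvable`, `ExitAt`, `GeFourReachExit`), …NatStageCut.lean (`singSet` users,
`ReachIsolatedAt`, `GeFourReachIsolated`), …ReducedStalkOverIso.lean (`stub_reducedStalkOverIso`), …NatFirstTouch.lean (`closure_preimage_diff_inter_compl_eq`),
…NatFirstProgressTouch.lean (`exists_unique_over_of_isIso_restrict`), …NatPointStep.lean (`isRegularLocalRing_stalk_iff_of_iso`).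
-/

set_option linter.dupNamespace false -- mandated namespace `Summit.<Summit>.<Problem>` of this single-conjunct summit

noncomputable section

open CategoryTheory CategoryTheory.Limits AlgebraicGeometry TopologicalSpace Topology
open Literature.AlgebraicGeometry.Resolution
open AlgebraicGeometry.Scheme.IdealSheafData
open Summit.ResolutionOfSingularities.ResolutionOfSingularities.Theses.EquisingularLift.Split
open Summit.ResolutionOfSingularities.ResolutionOfSingularities.Cruxes.EquisingularLift.StrataSplit
open Summit.ResolutionOfSingularities.ResolutionOfSingularities.Cruxes.EquisingularLiftNat.Sections
open Summit.ResolutionOfSingularities.ResolutionOfSingularities.Theorems.EquisingularLift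
open Summit.ResolutionOfSingularities.ResolutionOfSingularities.Theorems.EquisingularLiftNatStageCut

namespace Summit.ResolutionOfSingularities.ResolutionOfSingularities.Theorems.EquisingularLiftNatPointExit

/-! ## One point blow-up downstairs: partners persist off the centre -/

/-- **Partners persist off the blown-up point.** `υ : F₂ → F₁` the blow-up of the reduced closed point `P = ι x`; for every point `x₁` of
`V(closure T₁)_red` with `ι x₁ ≠ P` there is a point `x₂` of the new reduced strict transform `V(closure (closure υ⁻¹(T₁ ∖ {P})))_red` over it whose
local ring is regular iff that of `x₁` is. [folklore] -/
theorem exists_partner_of_point_blowup {F₁ F₂ : AlgebraicGeometry.Scheme.{0}} (T₁ : Set F₁)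
    (x : ↥(vanishingIdeal (⟨closure T₁, isClosed_closure⟩ : Closeds F₁)).subscheme)
    (hx : IsClosed ({((vanishingIdeal (⟨closure T₁, isClosed_closure⟩ : Closeds F₁)).subschemeι x : F₁)} : Set F₁))
    (υ : F₂ ⟶ F₁)
    (hυ : IsBlowup υ (vanishingIdeal (⟨{((vanishingIdeal (⟨closure T₁, isClosed_closure⟩ : Closeds F₁)).subschemeι x : F₁)}, hx⟩ : Closeds F₁)))
    (x₁ : ↥(vanishingIdeal (⟨closure T₁, isClosed_closure⟩ : Closeds F₁)).subscheme)
    (hx₁ : (vanishingIdeal (⟨closure T₁, isClosed_closure⟩ : Closeds F₁)).subschemeι x₁ ≠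
      (vanishingIdeal (⟨closure T₁, isClosed_closure⟩ : Closeds F₁)).subschemeι x) :
    ∃ x₂ : ↥(vanishingIdeal (⟨closure (closure (υ ⁻¹' (T₁ \
        {((vanishingIdeal (⟨closure T₁, isClosed_closure⟩ : Closeds F₁)).subschemeι x : F₁)}))), isClosed_closure⟩ : Closeds F₂)).subscheme,
      υ ((vanishingIdeal (⟨closure (closure (υ ⁻¹' (T₁ \
        {((vanishingIdeal (⟨closure T₁, isClosed_closure⟩ : Closeds F₁)).subschemeι x : F₁)}))), isClosed_closure⟩ : Closeds F₂)).subschemeι x₂) =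
        (vanishingIdeal (⟨closure T₁, isClosed_closure⟩ : Closeds F₁)).subschemeι x₁ ∧
      (IsRegularLocalRing ((vanishingIdeal (⟨closure (closure (υ ⁻¹' (T₁ \
          {((vanishingIdeal (⟨closure T₁, isClosed_closure⟩ : Closeds F₁)).subschemeι x : F₁)}))), isClosed_closure⟩ :
          Closeds F₂)).subscheme.presheaf.stalk x₂) ↔
        IsRegularLocalRing ((vanishingIdeal (⟨closure T₁, isClosed_closure⟩ : Closeds F₁)).subscheme.presheaf.stalk x₁)) := by
  -- the centre's support is `{P}`
  have hsuppx : ((vanishingIdeal (⟨{((vanishingIdeal (⟨closure T₁, isClosed_closure⟩ : Closeds F₁)).subschemeι x : F₁)}, hx⟩ :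
      Closeds F₁)).support : Set F₁) = {((vanishingIdeal (⟨closure T₁, isClosed_closure⟩ : Closeds F₁)).subschemeι x : F₁)} := by
    rw [AlgebraicGeometry.Scheme.IdealSheafData.coe_support_vanishingIdeal]; rfl
  -- the open complement of `P`; `υ` is an isomorphism over it
  let Wc : F₁.Opens := ⟨({((vanishingIdeal (⟨closure T₁, isClosed_closure⟩ : Closeds F₁)).subschemeι x : F₁)} : Set F₁)ᶜ, hx.isOpen_compl⟩
  have hWc : IsIso (υ ∣_ Wc) := hυ.isIso_morphismRestrict (U := Wc) (by
    change Disjoint ({((vanishingIdeal (⟨closure T₁, isClosed_closure⟩ : Closeds F₁)).subschemeι x : F₁)} : Set F₁)ᶜ _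
    rw [hsuppx]
    exact disjoint_compl_left)
  have hx₁W : ((vanishingIdeal (⟨closure T₁, isClosed_closure⟩ : Closeds F₁)).subschemeι x₁ : F₁) ∈ Wc := hx₁
  -- set bookkeeping over `Wc`
  have hZ : closure (closure (υ ⁻¹' (T₁ \ {((vanishingIdeal (⟨closure T₁, isClosed_closure⟩ : Closeds F₁)).subschemeι x : F₁)}))) ∩
      υ ⁻¹' ({((vanishingIdeal (⟨closure T₁, isClosed_closure⟩ : Closeds F₁)).subschemeι x : F₁)} : Set F₁)ᶜ =
      υ ⁻¹' closure T₁ ∩ υ ⁻¹' ({((vanishingIdeal (⟨closure T₁, isClosed_closure⟩ : Closeds F₁)).subschemeι x : F₁)} : Set F₁)ᶜ := by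
    have h := closure_preimage_diff_inter_compl_eq υ _ hυ T₁
    rw [hsuppx] at h
    exact h
  -- the point `y₂` over `ι x₁`, and its lift `x₂` to the new reduced strict transform
  obtain ⟨y₂, hy₂, -, -⟩ := exists_unique_over_of_isIso_restrict υ hx₁W hWc
  have hrange₁ : Set.range (vanishingIdeal (⟨closure T₁, isClosed_closure⟩ : Closeds F₁)).subschemeι = closure T₁ := by
    rw [AlgebraicGeometry.Scheme.IdealSheafData.range_subschemeι, AlgebraicGeometry.Scheme.IdealSheafData.coe_support_vanishingIdeal]; rfl
  have hrange₂ : Set.range (vanishingIdeal (⟨closure (closure (υ ⁻¹' (T₁ \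
      {((vanishingIdeal (⟨closure T₁, isClosed_closure⟩ : Closeds F₁)).subschemeι x : F₁)}))), isClosed_closure⟩ : Closeds F₂)).subschemeι =
      closure (closure (υ ⁻¹' (T₁ \ {((vanishingIdeal (⟨closure T₁, isClosed_closure⟩ : Closeds F₁)).subschemeι x : F₁)}))) := by
    rw [AlgebraicGeometry.Scheme.IdealSheafData.range_subschemeι, AlgebraicGeometry.Scheme.IdealSheafData.coe_support_vanishingIdeal]; rfl
  have hy₂mem : y₂ ∈ closure (closure (υ ⁻¹' (T₁ \ {((vanishingIdeal (⟨closure T₁, isClosed_closure⟩ : Closeds F₁)).subschemeι x : F₁)}))) := by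
    have h1 : y₂ ∈ υ ⁻¹' closure T₁ ∩ υ ⁻¹' ({((vanishingIdeal (⟨closure T₁, isClosed_closure⟩ : Closeds F₁)).subschemeι x : F₁)} : Set F₁)ᶜ := by
      refine ⟨?_, ?_⟩
      · show υ y₂ ∈ closure T₁
        rw [hy₂]; exact (Set.ext_iff.mp hrange₁ _).mp (Set.mem_range_self _)
      · show υ y₂ ∈ ({((vanishingIdeal (⟨closure T₁, isClosed_closure⟩ : Closeds F₁)).subschemeι x : F₁)} : Set F₁)ᶜ
        rw [hy₂]; exact hx₁
    rw [← hZ] at h1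
    exact h1.1
  obtain ⟨x₂, hx₂⟩ := (Set.ext_iff.mp hrange₂ y₂).mpr hy₂mem
  refine ⟨x₂, by rw [hx₂, hy₂], ?_⟩
  exact stub_reducedStalkOverIso F₁ F₂ υ Wc hWc ⟨closure T₁, isClosed_closure⟩
    ⟨closure (closure (υ ⁻¹' (T₁ \ {((vanishingIdeal (⟨closure T₁, isClosed_closure⟩ : Closeds F₁)).subschemeι x : F₁)}))), isClosed_closure⟩
    hZ x₂ x₁ (by rw [hx₂, hy₂]) hx₁W

/-! ## Point-resolvable ⇒ finitely many non-regular points -/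

/-- **A POINT-RESOLVABLE CONFIGURATION HAS FINITELY MANY NON-REGULAR POINTS** (all scheme points of `V(closure T₀)_red`): see the module docstring
for the partner invariant. [folklore] -/
theorem ptResolvable_singSet_finite (F₀ : AlgebraicGeometry.Scheme.{0}) (T₀ : Set F₀) :
    PtResolvable F₀ T₀ → (singSet T₀).Finite := by
  rintro ⟨F', ρ', T', hclos, hreg⟩
  -- the partner invariant
  let Q : ∀ F₁ : Scheme.{0}, (F₁ ⟶ F₀) → Set F₁ → Prop := fun F₁ ρ T₁ =>
    ∃ Φ : Set ↥(vanishingIdeal (⟨closure T₀, isClosed_closure⟩ : Closeds F₀)).subscheme, Φ.Finite ∧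
      ∀ x₀ : ↥(vanishingIdeal (⟨closure T₀, isClosed_closure⟩ : Closeds F₀)).subscheme, x₀ ∉ Φ →
        ∃ x₁ : ↥(vanishingIdeal (⟨closure T₁, isClosed_closure⟩ : Closeds F₁)).subscheme,
          ρ ((vanishingIdeal (⟨closure T₁, isClosed_closure⟩ : Closeds F₁)).subschemeι x₁) =
            (vanishingIdeal (⟨closure T₀, isClosed_closure⟩ : Closeds F₀)).subschemeι x₀ ∧
          (IsRegularLocalRing ((vanishingIdeal (⟨closure T₁, isClosed_closure⟩ : Closeds F₁)).subscheme.presheaf.stalk x₁) ↔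
            IsRegularLocalRing ((vanishingIdeal (⟨closure T₀, isClosed_closure⟩ : Closeds F₀)).subscheme.presheaf.stalk x₀))
  have hQ : Q F' ρ' T' := by
    refine hclos Q ?_ ?_
    · -- BASE: no exceptions, everybody is its own partner
      refine ⟨∅, Set.finite_empty, fun x₀ _ => ⟨x₀, by simp, Iff.rfl⟩⟩
    · -- STEP: one point blow-up
      intro F₁ F₂ ρ T₁ x υ hx hQ₁ _ hυ
      obtain ⟨Φ, hΦ, hpart⟩ := hQ₁
      refine ⟨Φ ∪ (vanishingIdeal (⟨closure T₀, isClosed_closure⟩ : Closeds F₀)).subschemeι ⁻¹'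
          {ρ ((vanishingIdeal (⟨closure T₁, isClosed_closure⟩ : Closeds F₁)).subschemeι x)},
        hΦ.union ((Set.finite_singleton _).preimage fun _ _ _ _ h =>
          (vanishingIdeal (⟨closure T₀, isClosed_closure⟩ : Closeds F₀)).subschemeι.isClosedEmbedding.injective h), ?_⟩
      intro x₀ hx₀
      rw [Set.mem_union, not_or] at hx₀
      obtain ⟨x₁, hρx₁, hiff₁⟩ := hpart x₀ hx₀.1
      have hne : (vanishingIdeal (⟨closure T₁, isClosed_closure⟩ : Closeds F₁)).subschemeι x₁ ≠
          (vanishingIdeal (⟨closure T₁, isClosed_closure⟩ : Closeds F₁)).subschemeι x := by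
        intro h
        apply hx₀.2
        rw [Set.mem_preimage, Set.mem_singleton_iff, ← hρx₁, h]
      obtain ⟨x₂, hυx₂, hiff₂⟩ := exists_partner_of_point_blowup T₁ x hx υ hυ x₁ hne
      exact ⟨x₂, by rw [Scheme.Hom.comp_apply, hυx₂, hρx₁], hiff₂.trans hiff₁⟩
  -- THE END: every point outside `Φ` has a regular partner
  obtain ⟨Φ, hΦ, hpart⟩ := hQ
  refine hΦ.subset fun x₀ hx₀ => ?_
  by_contra hmem
  obtain ⟨x₁, -, hiff⟩ := hpart x₀ hmem
  exact hx₀ (hiff.mp (hreg x₁))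

/-! ## Transport across an isomorphism of reduced strict transforms; exit ⇒ isolated -/

/-- Finiteness of the non-regular locus is invariant under an isomorphism of the reduced strict transforms. [folklore] -/
theorem singSet_finite_of_iso {F₀ X₁ : AlgebraicGeometry.Scheme.{0}} {T₀ : Set F₀} {S₁ : Set X₁}
    (e : (vanishingIdeal (⟨closure T₀, isClosed_closure⟩ : Closeds F₀)).subscheme ≅
      (vanishingIdeal (⟨closure S₁, isClosed_closure⟩ : Closeds X₁)).subscheme)
    (h : (singSet T₀).Finite) : (singSet S₁).Finite := by
  refine (h.image e.hom).subset fun x hx => ?_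
  refine ⟨e.inv x, ?_, by simp⟩
  intro hreg
  apply hx
  have h1 := (isRegularLocalRing_stalk_iff_of_iso e (e.inv x)).mpr hreg
  have h2 : e.hom (e.inv x) = x := by simp
  rw [h2] at h1
  exact h1

/-- **EXIT ⇒ ISOLATED; «reach an exit» ⇒ piece A on the band.** `GeFourReachExit p → GeFourReachIsolated p`: the exit stage's reduced strict transform
is isomorphic to a point-resolvable configuration, which has finitely many non-regular points (`ptResolvable_singSet_finite`), and `GoodSet` is part of
`ExitAt`. [folklore] -/
theorem geFourReachIsolated_of_geFourReachExit (p : ℕ) : GeFourReachExit p → GeFourReachIsolated p := by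
  intro hG hp k _ _ _ n H ι hι hH hloc hn hHreg
  obtain ⟨O, i1, i2, i3, i4, i5, π, hπ, hE'⟩ := hG hp k n H ι hι hH hloc hn hHreg
  refine ⟨O, i1, i2, i3, i4, i5, π, hπ, ?_⟩
  letI := MvPolynomial.gradedAlgebra (σ := Fin (n + 1)) (R := O)
  letI := MvPolynomial.gradedAlgebra (σ := Fin (n + 1)) (R := k)
  intro φ hφ' hφ Y hY
  obtain ⟨X₁, σ₁, S₁, hH₁, hgood, F₀, hF₀, T₀, -, ⟨e⟩, hres⟩ := hE' φ hφ' hφ Y hY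
  exact ⟨X₁, σ₁, S₁, hH₁, singSet_finite_of_iso e (ptResolvable_singSet_finite F₀ T₀ hres), hgood⟩

end Summit.ResolutionOfSingularities.ResolutionOfSingularities.Theorems.EquisingularLiftNatPointExit

end
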